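import Mathlib
import Summits.Ventures.HodgeRepro.Tier4.Common.AdelicDefs
import Summits.Ventures.HodgeRepro.Tier4.Common.CongruenceAdeles
import Summits.Ventures.HodgeRepro.Tier4.Common.CompactOpenLevel
import Summits.Ventures.HodgeRepro.Tier4.Common.LocalTorus
import Summits.Ventures.HodgeRepro.Tier4.Line1.AdelicParts
import Summits.Ventures.HodgeRepro.Tier4.Line1.FiniteLevelIsolation
import Summits.Ventures.HodgeRepro.Tier4.Line4.LevelCosetCongruence
import Summits.Ventures.HodgeRepro.Tier4.Line4.FinitePlacePositivity
import Summits.Ventures.HodgeRepro.Tier4.Line4.FinitePartCongruence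

/-!
# Tier4/Line4/LevelIndexIntegral — THE INDEX BOUND, integral case: `K(N) γ₀ K(N) = γ₀ K(N)` and
`μ₀(K(N) γ₀ K(N)) = μ₀(K(N))` for `γ₀` finite-integral with finite-integral inverse (C-L4-INDEX, plan-4 (γ) S15319)

Blind re-derivation cell `pub-hodge-repro`, Tier 4 «prove the step» (README §9–§10), seat t4-L1-p3 (gen 4).
Tree path `lean/Summits/Ventures/HodgeRepro/Tier4/Line4/LevelIndexIntegral.lean`.

The `l1` clause of the witness of record (`ffinMu`) is the double-coset index `[K(N) : K(N) ∩ γ₀ K(N) γ₀⁻¹] ≤ M₁`.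
When `γ₀` is finite-integral with finite-integral inverse the level subgroup is NORMALISED by `γ₀`
(`conj_mem_levelK`: `γ₀ (κ − 1) γ₀⁻¹` is integral × congruence × integral entrywise, with archimedean part `0`), so
`K(N) γ₀ K(N) = γ₀ K(N)` (`levelDoubleCoset_eq_of_isIntegralFin`) and, for any left-invariant measure `μ₀` on the finite
part `G(𝔸_f)`, `μ₀(K(N) γ₀,f K(N)) = μ₀(K(N))` (`measure_levelDoubleCoset_eq`): the index is `1` at EVERY level —
L1-p1's `hidx` (NaturalWitnessMu) with `M₁ = 1`, `∀ N` (not only along `qⁿ`).  The sets are the preimages in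
`finitePart W` of `levelDoubleCoset W N (GA.ofFinPart W γ₀)` and `↑(levelK W N)` — L1-p1's `levelDoubleCosetSet` /
`levelKSet` by `rfl`.  The general case (denominators of `γ₀`) is not here.  No printed input.
HC_CM is NOT proved by anyone in this repository.
-/

namespace Summit.Ventures.HodgeRepro.Tier4.Line4

open Summit.Ventures.HodgeRepro.Tier4.Common Summit.Ventures.HodgeRepro.Tier4.Line1 NumberField Matrix
  MeasureTheory
open scoped NumberField Pointwise

section Conj

variable {k : Type} [Field k] [NumberField k] (W : PlaneData k)

/-- Entrywise: `A (K − 1) B ≡ 0 (mod N)` for finite-integral `A, B` and `K ≡ 1 (mod N)`. -/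
theorem isCongr_mul_sub_one_mul {N : ℕ} {A B K : M4 k} (hA : IsIntegralFinMat A) (hB : IsIntegralFinMat B)
    (hK : IsCongr k N K) (i j : Fin 4) : (A * (K - 1) * B) i j ∈ congrSet k N := by
  rw [Matrix.mul_apply]
  refine sum_mem_congrSet k _ fun m _ => ?_
  refine mul_mem_congrSet_of_integral k ?_ (hB m j)
  rw [Matrix.mul_apply]
  refine sum_mem_congrSet k _ fun l _ => ?_
  exact mul_mem_congrSet_of_integral' k (hA i l) (hK l m)

/-- **Conjugation by an integral `γ₀` with integral inverse preserves `K(N)`.** -/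
theorem conj_mem_levelK {N : ℕ} {γ₀ : GA W} (h1 : IsIntegralFin W γ₀) (h2 : IsIntegralFin W γ₀⁻¹)
    {κ : GA W} (hκ : κ ∈ levelK W N) : γ₀ * κ * γ₀⁻¹ ∈ levelK W N := by
  rw [mem_levelK] at hκ ⊢
  obtain ⟨hκ1, hκ2⟩ := hκ
  have key : ∀ {κ' : GA W}, IsCongr k N (GA.mat W κ') → IsCongr k N (GA.mat W (γ₀ * κ' * γ₀⁻¹)) := by
    intro κ' hκ' i j
    have hsplit : GA.mat W (γ₀ * κ' * γ₀⁻¹) - 1 = GA.mat W γ₀ * (GA.mat W κ' - 1) * GA.mat W γ₀⁻¹ := by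
      rw [GA.mat_mul, GA.mat_mul, Matrix.mul_sub, Matrix.sub_mul, Matrix.mul_one, GA.mat_mul_inv]
    rw [hsplit]
    exact isCongr_mul_sub_one_mul h1 h2 hκ' i j
  refine ⟨key hκ1, ?_⟩
  have hinv : (γ₀ * κ * γ₀⁻¹)⁻¹ = γ₀ * κ⁻¹ * γ₀⁻¹ := by group
  rw [hinv]
  exact key hκ2

/-- **`K(N) γ₀ K(N) = γ₀ K(N)` for integral `γ₀` with integral inverse** (the index is `1`). -/
theorem levelDoubleCoset_eq_of_isIntegralFin {N : ℕ} {γ₀ : GA W} (h1 : IsIntegralFin W γ₀)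
    (h2 : IsIntegralFin W γ₀⁻¹) :
    levelDoubleCoset W N γ₀ = {γ₀} * (levelK W N : Set (GA W)) := by
  have h2' : IsIntegralFin W (γ₀⁻¹)⁻¹ := by rw [inv_inv]; exact h1
  ext g
  constructor
  · intro hg
    obtain ⟨κ, hκ, κ', hκ', rfl⟩ := exists_eq_mul_of_mem_mul_singleton_mul W _ γ₀ g hg
    refine ⟨γ₀, rfl, (γ₀⁻¹ * κ * γ₀⁻¹⁻¹) * κ', ?_, ?_⟩
    · exact (levelK W N).mul_mem (conj_mem_levelK W h2 h2' hκ) hκ'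
    · simp only [inv_inv]
      group
  · rintro ⟨x, hx, κ, hκ, rfl⟩
    exact ⟨x, ⟨1, (levelK W N).one_mem, x, hx, one_mul x⟩, κ, hκ, rfl⟩

end Conj

section Measure

variable {k : Type} [Field k] [NumberField k] (W : PlaneData k)

/-- The preimage in `G(𝔸_f)` of a left translate `{g₀} * S` (`g₀ ∈ G(𝔸_f)`) is the preimage of the preimage of `S`
under left multiplication by `g₀⁻¹`. -/
theorem preimage_singleton_mul {g₀ : GA W} (hg₀ : g₀ ∈ finitePart W) (S : Set (GA W)) :
    (Subtype.val : finitePart W → GA W) ⁻¹' ({g₀} * S) =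
      (fun h : finitePart W => (⟨g₀, hg₀⟩ : finitePart W)⁻¹ * h) ⁻¹'
        ((Subtype.val : finitePart W → GA W) ⁻¹' S) := by
  refine Set.ext fun x => ?_
  simp only [Set.mem_preimage, Subgroup.coe_mul, Subgroup.coe_inv]
  constructor
  · rintro ⟨y, hy, s, hs, hx⟩
    rw [Set.mem_singleton_iff] at hy
    rw [← hx, hy, inv_mul_cancel_left]
    exact hs
  · intro h
    exact ⟨g₀, rfl, g₀⁻¹ * (x : GA W), h, mul_inv_cancel_left g₀ (x : GA W)⟩

/-- **THE INDEX BOUND, integral case**: for a left-invariant `μ₀` on `G(𝔸_f)` and `γ₀` finite-integral with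
finite-integral inverse, `μ₀(K(N) γ₀,f K(N)) = μ₀(K(N))` — L1-p1's `hidx` with `M₁ = 1` at every level. -/
theorem measure_levelDoubleCoset_eq [MeasurableSpace (finitePart W)] [BorelSpace (finitePart W)]
    (μ₀ : Measure (finitePart W)) [μ₀.IsMulLeftInvariant] {N : ℕ} {γ₀ : GA W}
    (h1 : IsIntegralFin W γ₀) (h2 : IsIntegralFin W γ₀⁻¹) :
    μ₀ ((Subtype.val : finitePart W → GA W) ⁻¹' levelDoubleCoset W N (GA.ofFinPart W γ₀)) =
      μ₀ ((Subtype.val : finitePart W → GA W) ⁻¹' (levelK W N : Set (GA W))) := by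
  have h1' : IsIntegralFin W (GA.ofFinPart W γ₀) := IsIntegralFin.ofFinPart W h1
  have h2' : IsIntegralFin W (GA.ofFinPart W γ₀)⁻¹ := by
    rw [← ofFinPart_inv]
    exact IsIntegralFin.ofFinPart W h2
  rw [levelDoubleCoset_eq_of_isIntegralFin W h1' h2',
    preimage_singleton_mul W (ofFinPart_mem_finitePart W γ₀)]
  exact measure_preimage_mul μ₀ _ _

/-- The same in the `toReal` form of `hidx`, with `M₁ = 1`. -/
theorem measure_levelDoubleCoset_toReal_le [MeasurableSpace (finitePart W)] [BorelSpace (finitePart W)]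
    (μ₀ : Measure (finitePart W)) [μ₀.IsMulLeftInvariant] {N : ℕ} {γ₀ : GA W}
    (h1 : IsIntegralFin W γ₀) (h2 : IsIntegralFin W γ₀⁻¹) :
    (μ₀ ((Subtype.val : finitePart W → GA W) ⁻¹' levelDoubleCoset W N (GA.ofFinPart W γ₀))).toReal ≤
      1 * (μ₀ ((Subtype.val : finitePart W → GA W) ⁻¹' (levelK W N : Set (GA W)))).toReal := by
  rw [measure_levelDoubleCoset_eq W μ₀ h1 h2, one_mul]

end Measure

end Summit.Ventures.HodgeRepro.Tier4.Line4
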